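import Summits.QuantumFields.YangMills.Theses.SandwichVariancePinching
import Summits.QuantumFields.YangMills.Theorems.LogConcaveChartTransportIsotropicReduction
import Summits.QuantumFields.YangMills.Theorems.SandwichVariancePinchingScoreCalculus

/-!
# Route `SandwichVariancePinching` — crux `QuadraticVarianceFloor` (stmt-QuantumFields-28260):
# **WHITENING** — the floor in the isotropic frame `H₀ = 1` implies the floor for every `H₀ ≻ 0`

`quadraticVarianceFloor_of_whitened`: if the variance floor holds in the frame `H₀ = 1` (for all dimensions,
all symmetric `H`, all `b`, all CONTINUOUS centred potentials with the Euclidean second-difference sandwich;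
written out as the hypothesis — it is the planner's `FloorWhitened`, no new definition), then the crux
`QuadraticVarianceFloor` holds BY NAME (with the same `C` and `δ₀ ∧ 1/2`).  Conjugate by `P = H₀^{1/2}`
(`Cruxes.TransportCovarianceTransfer.exists_symm_sqrt`): `Ã(y) = A(P⁻¹y)` is continuous, Euclidean-sandwiched
(`sandwich_conj`) and centred (linear change of variables `integral_comp_mulVec` + centring of `A`), the
observable becomes `(P⁻¹HP⁻¹, P⁻¹b)` (`quadObs_conj`), the Gibbs ratios are invariant (`integral_div_comp_mulVec`,
the Jacobian cancels) and `rV` is invariant (`trace_conj_mul_conj`, `conj_dotProduct_conj`).  This is the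
planner's `stub_whitenFloor` (BC3 skeleton `QuadraticVarianceFloor_birth.lean`, evidence on 28260).

HONEST SCOPE.  Free-hands work of the LEAD seat of crux stmt-QuantumFields-22884 (cell ym-idea-1).  A
reduction only: it does NOT prove the whitened floor for continuous potentials (the smooth case is
`floorWhitened_of_contDiff`; the mollification step is open), hence does not close `QuadraticVarianceFloor`,
`QuadraticVarianceCeiling`, `LogConcaveChart.QuadraticCovarianceComparison` (26240), rung R2a or any summit
statement; the Yang–Mills mass gap is NOT proved by any of this.
-/

noncomputable section

namespace Summit.QuantumFields.YangMills.Theorems.SandwichVariancePinching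

open MeasureTheory Real Matrix
open Summit.QuantumFields.YangMills.Cruxes.TransportCovarianceTransfer

variable {n : ℕ}

/-- CENTRING IN THE WHITENED FRAME: if `∫ x_i e^{−A} = 0` for all `i` (with the integrands integrable)
then `∫ y_i e^{−A(P⁻¹y)} dy = 0` for `det P ≠ 0`. [folklore] -/
theorem centring_conj {P : Matrix (Fin n) (Fin n) ℝ} (hP : P.det ≠ 0) {A : (Fin n → ℝ) → ℝ}
    (hint : ∀ i : Fin n, Integrable fun x : Fin n → ℝ => x i * exp (-A x))
    (hcent : ∀ i : Fin n, ∫ x, x i * exp (-A x) = 0) (i : Fin n) :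
    ∫ y, y i * exp (-A (P⁻¹ *ᵥ y)) = 0 := by
  have h := integral_comp_mulVec hP fun y => y i * exp (-A (P⁻¹ *ᵥ y))
  simp only [inv_mulVec_mulVec hP] at h
  -- `h : ∫ x, (P x)_i e^{−A x} = |det P|⁻¹ ∫ y, y_i e^{−A(P⁻¹ y)}`
  have hd : |P.det|⁻¹ ≠ 0 := inv_ne_zero (abs_ne_zero.mpr hP)
  have hL : ∫ x, (P *ᵥ x) i * exp (-A x) = 0 := by
    have e : (fun x : Fin n → ℝ => (P *ᵥ x) i * exp (-A x)) =
        fun x => ∑ j, P i j * (x j * exp (-A x)) := by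
      funext x
      simp only [Matrix.mulVec, dotProduct, Finset.sum_mul]
      exact Finset.sum_congr rfl fun j _ => by ring
    rw [e, integral_finsetSum _ fun j _ => (hint j).const_mul _]
    exact Finset.sum_eq_zero fun j _ => by rw [integral_const_mul, hcent j, mul_zero]
  rw [hL] at h
  exact (mul_eq_zero.mp h.symm).resolve_left hd

/-- **WHITENING FOR THE VARIANCE FLOOR**: the floor in the frame `H₀ = 1` (hypothesis, = the planner's
`FloorWhitened`) implies the crux `QuadraticVarianceFloor` for every positive definite `H₀`. [folklore] -/
theorem quadraticVarianceFloor_of_whitened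
    (hw : ∃ (C δ₀ : ℝ), 0 ≤ C ∧ 0 < δ₀ ∧ δ₀ ≤ 1 ∧ ∀ δ : ℝ, 0 ≤ δ → δ ≤ δ₀ →
      ∀ (n : ℕ) (H : Matrix (Fin n) (Fin n) ℝ) (b : Fin n → ℝ) (A : (Fin n → ℝ) → ℝ),
        H.IsSymm → Continuous A →
        (∀ x h : Fin n → ℝ, (1 - δ) * (h ⬝ᵥ h) ≤ A (x + h) + A (x - h) - 2 * A x ∧
          A (x + h) + A (x - h) - 2 * A x ≤ (1 + δ) * (h ⬝ᵥ h)) →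
        (∀ i : Fin n, ∫ x, x i * Real.exp (-A x) = 0) →
        (1 - C * δ) * (2 * (H * H).trace + b ⬝ᵥ b) ≤
          (∫ x, (x ⬝ᵥ H.mulVec x + b ⬝ᵥ x) * (x ⬝ᵥ H.mulVec x + b ⬝ᵥ x) * Real.exp (-A x)) /
              (∫ x, Real.exp (-A x)) -
            (∫ x, (x ⬝ᵥ H.mulVec x + b ⬝ᵥ x) * Real.exp (-A x)) / (∫ x, Real.exp (-A x)) *
              ((∫ x, (x ⬝ᵥ H.mulVec x + b ⬝ᵥ x) * Real.exp (-A x)) / (∫ x, Real.exp (-A x)))) :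
    Summit.QuantumFields.YangMills.Theses.SandwichVariancePinching.QuadraticVarianceFloor := by
  obtain ⟨C, δ₀, hC, hδ₀, hδ₀1, hw⟩ := hw
  refine ⟨C, min δ₀ (1 / 2), hC, lt_min hδ₀ (by norm_num), (min_le_left _ _).trans hδ₀1, ?_⟩
  intro δ hδ hδm n H₀ H b A hH₀ hH hA hsw hcent gE q rV
  have hδ₀' : δ ≤ δ₀ := hδm.trans (min_le_left _ _)
  have hδ1 : δ < 1 := lt_of_le_of_lt (hδm.trans (min_le_right _ _)) (by norm_num)
  obtain ⟨P, hPs, hP, hPP⟩ := exists_symm_sqrt hH₀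
  have hQs : P⁻¹.IsSymm := isSymm_inv hPs
  have hQQ : P⁻¹ * P⁻¹ = H₀⁻¹ := by rw [← Matrix.mul_inv_rev, hPP]
  have hQdet : (P⁻¹).det ≠ 0 := by
    rw [Matrix.det_nonsing_inv, Ring.inverse_eq_inv']
    exact inv_ne_zero hP
  -- the whitened potential
  set At : (Fin n → ℝ) → ℝ := fun y => A (P⁻¹ *ᵥ y) with hAt
  have hAtc : Continuous At := hA.comp (Matrix.mulVecLin P⁻¹).toContinuousLinearMap.continuous
  have hswt : ∀ y k : Fin n → ℝ, (1 - δ) * (k ⬝ᵥ k) ≤ At (y + k) + At (y - k) - 2 * At y ∧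
      At (y + k) + At (y - k) - 2 * At y ≤ (1 + δ) * (k ⬝ᵥ k) := fun y k =>
    sandwich_conj hPs hP hPP hsw y k
  -- centring of the whitened potential (integrability from the repaired `SandwichMoments`)
  have hmom := sandwichMoments_of_lt_one δ hδ hδ1 n H₀ A hH₀ hA hsw
  have hint : ∀ i : Fin n, Integrable fun x : Fin n → ℝ => x i * exp (-A x) := fun i => by
    have h := (hmom.2.2 0 0 (Pi.single i 1) 0).1
    refine h.congr (ae_of_all _ fun x => ?_)
    simp [Matrix.zero_mulVec]
  have hcentt : ∀ i : Fin n, ∫ y, y i * exp (-At y) = 0 := fun i =>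
    centring_conj hP hint hcent i
  -- the floor in the whitened frame
  have key := hw δ hδ hδ₀' n (P⁻¹ * H * P⁻¹) (P⁻¹ *ᵥ b) At (isSymm_conj hQs hH) hAtc hswt hcentt
  -- identify the constants
  rw [trace_conj_mul_conj _ _ _ _ hQQ, conj_dotProduct_conj hQs hQQ] at key
  -- identify the Gibbs ratios: `q̃(y) = q(P⁻¹ y)` and the Jacobian cancels
  simp only [quadObs_conj hQs, hAt] at key
  have r1 := integral_div_comp_mulVec hQdet
    (fun x => (x ⬝ᵥ H *ᵥ x + b ⬝ᵥ x) * (x ⬝ᵥ H *ᵥ x + b ⬝ᵥ x) * exp (-A x)) (fun x => exp (-A x))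
  have r2 := integral_div_comp_mulVec hQdet
    (fun x => (x ⬝ᵥ H *ᵥ x + b ⬝ᵥ x) * exp (-A x)) (fun x => exp (-A x))
  rw [r1, r2] at key
  exact key

end Summit.QuantumFields.YangMills.Theorems.SandwichVariancePinching

end
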